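import Mathlib
import Summits.RiemannHypothesis.RiemannHypothesis.Theorems.WeilFarFloorCoshTest
import Summits.RiemannHypothesis.RiemannHypothesis.Theorems.WeilFarFloorMainTermExact
import Summits.RiemannHypothesis.RiemannHypothesis.Theorems.WeilFarFloorLogRieszLandau
import Literature.NumberTheory.LFunctions.GeneralizedRH
import HarnessLib

/-!
# The floor law C-XIII implies the Riemann Hypothesis

Helper file (`--supports stmt-RiemannHypothesis-0098`, lead-track anchor: Weil-positivity window ladder, format-C far bound),
pure proofs.  Seat rh-explicit-weil-1 gen9, re-based by gen13 on `WeilFarFloorMainTermExact` (memo FORMAT-K3 §10.7, §14.7).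
STRUCTURE.md's conjecture C-XIII (`WeilFarCoercivityFloor.FarFloorDiscrepancyLe C a₀`: `|λ_max(a) − (pntFloor a − 2γ_E)| ≤ C`
for all `a ≥ a₀`) is at least as strong as RH: **`FarFloorDiscrepancyLe C a₀ → RiemannHypothesis`**
(`riemannHypothesis_of_farFloorDiscrepancyLe`; only the UPPER half `λ_max(a) ≤ pntFloor a − 2γ_E + C` is used,
`riemannHypothesis_of_farFloor_le`).  Proof: the near-extremizer `χ_a = cosh(x/2)·1_{[−a,a]}` of `WeilFarFloorCoshTest` has
`λ_max(a)·(a + sinh a) ≥ Q_a(χ_a) ≥ e^a(2a − 4) − e^{−a}ψ(e^{2a}) + ½W(e^{2a})`, `W(x) = ∫₁ˣψ(t)dt/t`; with `pntFloor a ≤ e^a + 2a`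
(`WeilFarFloorMainTermExact`, `a ≥ 6`) the upper clause gives `W(x) − x ≤ K√x` for all large `x` (`logRiesz_sub_le_of_farFloor_le`), whereas a
zero `ρ₀` of `ζ` with `Re ρ₀ > ½` forces `W(x) − x ≥ x^b`, `b = (½ + Re ρ₀)/2`, for arbitrarily large `x`
(`WeilFarFloorLogRieszLandau`, Landau's theorem); `QuasiRiemannHypothesis (1/2) ↔ RiemannHypothesis` (Literature `GeneralizedRH`)
finishes.  Together with `WeilFarFloorCoshTestRH` (RH ⟹ the LOWER clause): lower-C-XIII ⟸ RH ⟸ C-XIII, so the content of the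
law beyond RH is the near-optimality of `χ_a` (upper clause).  Standard axioms only; nothing is asserted.
-/

set_option linter.dupNamespace false
set_option autoImplicit false

noncomputable section

open MeasureTheory Set Finset intervalIntegral Filter
open scoped Real BigOperators ArithmeticFunction.vonMangoldt Chebyshev


namespace Summit.RiemannHypothesis.RiemannHypothesis.Theorems.WeilFormatC

namespace LogRiesz

open Literature.NumberTheory.LFunctions

/-- **`Ω₋` for the logarithmic Riesz mean** (companion of `frequently_rpow_le_logRiesz_sub`): for a zero `ρ₀` of `ζ` and
`0 < b < Re ρ₀`, `W(x) − x ≤ −x^b` for arbitrarily large `x`. -/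
theorem frequently_logRiesz_sub_le_neg_rpow {ρ₀ : ℂ} (hζ : riemannZeta ρ₀ = 0) {b : ℝ} (hb0 : 0 < b)
    (hb : b < ρ₀.re) : ∃ᶠ x in atTop, (∫ t in (1:ℝ)..x, t⁻¹ * ψ t) - x ≤ -x ^ b := by
  have hρre : ρ₀.re < 1 := by
    by_contra h
    exact riemannZeta_ne_zero_of_one_le_re (not_lt.1 h) hζ
  have hb1 : b ≤ 1 := by linarith
  by_contra hnot
  rw [Filter.not_frequently] at hnot
  obtain ⟨X, hX⟩ := Filter.eventually_atTop.1 hnot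
  refine false_of_nonneg_of_zero (η := -1) (X₁ := max X 1) hb0 hb1 (Or.inr rfl) (le_max_right _ _)
    (fun x hx ↦ ?_) hζ hb
  have := hX x ((le_max_left _ _).trans hx.le)
  simp only [neg_mul, one_mul, sub_neg_eq_add, not_le] at this ⊢
  linarith

end LogRiesz

end Summit.RiemannHypothesis.RiemannHypothesis.Theorems.WeilFormatC

namespace Summit.RiemannHypothesis.RiemannHypothesis.Theorems.WeilFormatC

namespace FloorCosh

open Literature.NumberTheory.LFunctions

variable {a : ℝ}

/-- `54 + 54(a − 4) + 27(a − 4)² ≤ e^a` for `a ≥ 4` (`e⁴ ≥ 54` from `e > 2.718281828`; `e^a = e⁴·e^{a−4}`,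
`e^{a−4} ≥ 1 + (a−4) + (a−4)²/2`).  (The numerical fact `54 ≤ e⁴` is kept as a local step: the tree has it under
several names in unrelated files.) -/
theorem exp_ge_quadratic_of_four_le (ha : 4 ≤ a) : 54 + 54 * (a - 4) + 27 * (a - 4) ^ 2 ≤ Real.exp a := by
  have h4 : (54 : ℝ) ≤ Real.exp 4 := by
    have h1 := Real.exp_one_gt_d9
    have e4 : Real.exp 4 = Real.exp 1 ^ 4 := by rw [← Real.exp_nat_mul]; norm_num
    rw [e4]
    have h2 : (2.7182818283 : ℝ) ^ 2 < Real.exp 1 ^ 2 := by nlinarith [h1, Real.exp_pos 1]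
    have h3 : (7.38 : ℝ) < Real.exp 1 ^ 2 := by nlinarith [h2]
    nlinarith [h3, sq_nonneg (Real.exp 1 ^ 2)]
  have hq : 1 + (a - 4) + (a - 4) ^ 2 / 2 ≤ Real.exp (a - 4) := Real.quadratic_le_exp_of_nonneg (by linarith)
  have hsplit : Real.exp a = Real.exp 4 * Real.exp (a - 4) := by rw [← Real.exp_add]; ring_nf
  rw [hsplit]
  have hc : 0 ≤ 1 + (a - 4) + (a - 4) ^ 2 / 2 := by have := sq_nonneg (a - 4); linarith
  calc 54 + 54 * (a - 4) + 27 * (a - 4) ^ 2 = 54 * (1 + (a - 4) + (a - 4) ^ 2 / 2) := by ring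
    _ ≤ Real.exp 4 * Real.exp (a - 4) := mul_le_mul h4 hq hc (Real.exp_pos 4).le

/-- `pntFloor a ≤ e^a + 2a` for `a ≥ 6` (`WeilFarFloorMainTermExact`: `|pntFloor a − (e^a + 2a − 2)| ≤ 14a²e^{−a}`, and `7a² ≤ e^a`). -/
theorem pntFloor_le_exp_add_two_mul_of_six_le (ha : 6 ≤ a) : pntFloor a ≤ Real.exp a + 2 * a := by
  have h1 := (abs_le.1 (FloorMainTerm.abs_pntFloor_sub_le (a := a) (by linarith))).2
  have hq := exp_ge_quadratic_of_four_le (a := a) (by linarith)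
  have h7 : 7 * a ^ 2 ≤ Real.exp a := by nlinarith [hq]
  have hinv : Real.exp (-a) * Real.exp a = 1 := by rw [← Real.exp_add]; simp
  have h2 : 14 * a ^ 2 * Real.exp (-a) ≤ 2 := by
    have h3 := mul_le_mul_of_nonneg_left h7 (by positivity : (0:ℝ) ≤ 2 * Real.exp (-a))
    nlinarith [h3, hinv, Real.exp_pos (-a)]
  linarith

/-! ### From an upper bound on the floor to an upper bound on `W(x) − x` -/

/-- Arithmetic of the assembly (pure real inequality). -/
theorem law_arith1 {W E a C M P S sh Ei : ℝ} (hE0 : 0 ≤ E) (hQ : E * M - Ei * P + S ≤ (E + 2 * a + C) * (a + sh))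
    (hT : (E + 2 * a + C) * (a + sh) ≤ (E + 2 * a + |C|) * (a + E / 2)) (hMl : E * (2 * a - 4) ≤ E * M)
    (hEi0 : 0 ≤ Ei) (hEiE : Ei * E = 1) (hEi : Ei ≤ 1 / 20) (hP : P ≤ 1106 / 1000 * E ^ 2 + 12 * a ^ 2 + 80)
    (hW : W / 2 ≤ S) : W ≤ E ^ 2 + (|C| + 11) * E + 6 * a ^ 2 + 2 * |C| * a + 8 := by
  have hψl : Ei * P ≤ 1106 / 1000 * E + (12 * a ^ 2 + 80) / 20 := by
    have h := mul_le_mul_of_nonneg_left hP hEi0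
    have h' : Ei * (1106 / 1000 * E ^ 2) = 1106 / 1000 * E * (Ei * E) := by ring
    rw [hEiE, mul_one] at h'
    have h'' : Ei * (12 * a ^ 2 + 80) ≤ 1 / 20 * (12 * a ^ 2 + 80) := mul_le_mul_of_nonneg_right hEi (by positivity)
    nlinarith [h, h', h'']
  have hexp : (E + 2 * a + |C|) * (a + E / 2) = E ^ 2 / 2 + 2 * (a * E) + 2 * a ^ 2 + |C| * a + |C| * E / 2 := by ring
  have hexp2 : E * (2 * a - 4) = 2 * (a * E) - 4 * E := by ring
  nlinarith [hQ, hT, hMl, hψl, hW, hexp, hexp2, abs_nonneg C, mul_nonneg (abs_nonneg C) hE0, sq_nonneg a]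

/-- Arithmetic: the polynomial terms are `O(E)` (`E = e^a ≥ 54 + 54(a−4) + 27(a−4)²`, `a ≥ 4`). -/
theorem law_arith2 {E a C : ℝ} (ha4 : 4 ≤ a) (hEq : 54 + 54 * (a - 4) + 27 * (a - 4) ^ 2 ≤ E) (haE : a ≤ E) :
    6 * a ^ 2 + 2 * |C| * a + 8 ≤ (24 * 16 + 8 * |C| + 8) * E := by
  have h1 : (a - 4) ^ 2 ≤ E / 27 := by nlinarith
  have h2 : a ^ 2 ≤ 2 * (a - 4) ^ 2 + 32 := by nlinarith [sq_nonneg (a - 8)]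
  have h3 : |C| * a ≤ |C| * E := mul_le_mul_of_nonneg_left haE (abs_nonneg C)
  have hE1 : 1 ≤ E := by nlinarith
  nlinarith [abs_nonneg C, h1, h2, h3, hE1]

/-- Chebyshev from above at `x = e^{2a}` (`a > 0`): `ψ(⌊e^{2a}⌋) ≤ 1.106·(e^a)² + 12a² + 80` (the explicit bound
`ChebyshevExplicit.psi_le_chebyshev`). -/
theorem vonMangoldt_sum_floor_exp_le (ha : 0 < a) :
    ∑ n ∈ Finset.Ioc 0 ⌊Real.exp (2 * a)⌋₊, (Λ n : ℝ) ≤ 1106 / 1000 * Real.exp a ^ 2 + 12 * a ^ 2 + 80 := by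
  have hX1 : 1 ≤ Real.exp (2 * a) := Real.one_le_exp (by linarith)
  have hE2 : Real.exp (2 * a) = Real.exp a ^ 2 := by rw [← Real.exp_nat_mul]; norm_num
  have hψX : ψ (Real.exp (2 * a)) = ∑ n ∈ Finset.Ioc 0 ⌊Real.exp (2 * a)⌋₊, (Λ n : ℝ) := rfl
  rw [← hψX, Chebyshev.psi_eq_psi_coe_floor]
  have hA := Literature.NumberTheory.LFunctions.ChebyshevExplicit.A_bounds
  have h := Literature.NumberTheory.LFunctions.ChebyshevExplicit.psi_le_chebyshev ⌊Real.exp (2 * a)⌋₊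
  have hfl1 : (1 : ℝ) ≤ (⌊Real.exp (2 * a)⌋₊ : ℝ) := by exact_mod_cast Nat.le_floor (by exact_mod_cast hX1)
  have hflX : (⌊Real.exp (2 * a)⌋₊ : ℝ) ≤ Real.exp (2 * a) := Nat.floor_le (by linarith)
  have hlog : Real.log (⌊Real.exp (2 * a)⌋₊ : ℝ) ≤ 2 * a := by
    have := Real.log_le_log (by linarith) hflX; rwa [Real.log_exp] at this
  have hlog0 : 0 ≤ Real.log (⌊Real.exp (2 * a)⌋₊ : ℝ) := Real.log_nonneg hfl1
  have hsq : Real.log (⌊Real.exp (2 * a)⌋₊ : ℝ) ^ 2 ≤ (2 * a) ^ 2 := pow_le_pow_left₀ hlog0 hlog 2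
  have hmain : 6 / 5 * Literature.NumberTheory.LFunctions.ChebyshevExplicit.A * (⌊Real.exp (2 * a)⌋₊ : ℝ)
      ≤ 1106 / 1000 * Real.exp a ^ 2 :=
    (mul_le_mul_of_nonneg_right (by linarith [hA.2]) (by linarith)).trans
      (mul_le_mul_of_nonneg_left (hflX.trans hE2.le) (by norm_num))
  linarith

/-- The weighted prime sum of the cosh test dominates `W(e^{2a})/2 = ½∫₁^{e^{2a}} ψ(t)dt/t` (`a > 0`):
`W(e^{2a}) = Σ_{n ≤ e^{2a}} Λ(n)(2a − log n)` (`sum_vonMangoldt_mul_log_div_eq_integral`) and `1 ≤ 1 + 1/n`. -/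
theorem logRiesz_half_le_weightedSum (ha : 0 < a) :
    (∫ t in (1:ℝ)..Real.exp (2 * a), t⁻¹ * ψ t) / 2
      ≤ ∑ n ∈ Finset.Ioc 0 ⌊Real.exp (2 * a)⌋₊, (Λ n : ℝ) * ((2 * a - Real.log n) * (1 + 1 / n) / 2) := by
  have hX1 : 1 ≤ Real.exp (2 * a) := Real.one_le_exp (by linarith)
  have hI := sum_vonMangoldt_mul_log_div_eq_integral (Real.exp (2 * a))
  rw [Real.log_exp, ← intervalIntegral.integral_of_le hX1] at hI
  have hdrop : ∑ n ∈ Finset.Icc 0 ⌊Real.exp (2 * a)⌋₊, (2 * a - Real.log n) * (Λ n : ℝ)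
      = ∑ n ∈ Finset.Ioc 0 ⌊Real.exp (2 * a)⌋₊, (2 * a - Real.log n) * (Λ n : ℝ) := by
    rw [← Finset.sum_subset (Finset.Ioc_subset_Icc_self) fun n hn hn' ↦ by
      have h0 : n = 0 := by rw [Finset.mem_Icc] at hn; rw [Finset.mem_Ioc] at hn'; omega
      subst h0; simp]
  rw [hdrop] at hI
  have hterm : ∀ n ∈ Finset.Ioc 0 ⌊Real.exp (2 * a)⌋₊, (2 * a - Real.log n) * (Λ n : ℝ) / 2
      ≤ (Λ n : ℝ) * ((2 * a - Real.log n) * (1 + 1 / n) / 2) := by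
    intro n hn
    rw [Finset.mem_Ioc] at hn
    have hn0 : (0 : ℝ) < n := by exact_mod_cast hn.1
    have hlog : Real.log n ≤ 2 * a := by
      rw [Real.log_le_iff_le_exp hn0]
      exact (Nat.cast_le.2 hn.2).trans (Nat.floor_le (Real.exp_pos _).le)
    have hΛ : 0 ≤ (Λ n : ℝ) := ArithmeticFunction.vonMangoldt_nonneg
    have h1n : 0 ≤ 1 / (n : ℝ) := by positivity
    nlinarith [mul_nonneg hΛ (mul_nonneg (by linarith : 0 ≤ 2 * a - Real.log n) h1n)]
  calc (∫ t in (1:ℝ)..Real.exp (2 * a), t⁻¹ * ψ t) / 2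
        = (∑ n ∈ Finset.Ioc 0 ⌊Real.exp (2 * a)⌋₊, (2 * a - Real.log n) * (Λ n : ℝ)) / 2 := by rw [hI]
    _ = ∑ n ∈ Finset.Ioc 0 ⌊Real.exp (2 * a)⌋₊, (2 * a - Real.log n) * (Λ n : ℝ) / 2 := by rw [Finset.sum_div]
    _ ≤ _ := Finset.sum_le_sum hterm


/-- **The floor law's upper clause bounds the logarithmic Riesz mean**: if `λ_max(a) ≤ pntFloor a − 2γ_E + C` for all
`a ≥ a₀`, then `W(x) − x ≤ K√x` for all large `x`, `W(x) = ∫₁ˣψ(t)dt/t` (through `λ_max(a) ≥ Q_a(χ_a)/(a + sinh a)`,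
`Q_a(χ_a) ≥ e^a(2a − 4) − e^{−a}ψ(e^{2a}) + ½W(e^{2a})`, `pntFloor a ≤ e^a + 2a`). -/
theorem logRiesz_sub_le_of_farFloor_le {C a₀ : ℝ}
    (hU : ∀ a : ℝ, a₀ ≤ a → farCoercivityFloor a ≤ pntFloor a - 2 * Real.eulerMascheroniConstant + C) :
    ∃ K X₁ : ℝ, ∀ x : ℝ, X₁ ≤ x → (∫ t in (1:ℝ)..x, t⁻¹ * ψ t) - x ≤ K * Real.sqrt x := by
  have hγ : 0 ≤ Real.eulerMascheroniConstant := by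
    have := Real.one_half_lt_eulerMascheroniConstant; linarith
  -- constants: with `E = √x`, `a = log x / 2 ≥ 4`: `W(x) − x ≤ (|C| + 11)E + 6a² + 2|C|a + 8 ≤ K E`
  refine ⟨|C| + 11 + 24 * 16 + 8 * |C| + 8, max (Real.exp (2 * a₀)) (Real.exp 12), fun x hx ↦ ?_⟩
  have hx8 : Real.exp 12 ≤ x := (le_max_right _ _).trans hx
  have hx0 : 0 < x := lt_of_lt_of_le (Real.exp_pos 12) hx8
  have hx1 : 1 ≤ x := (Real.one_le_exp (by norm_num : (0:ℝ) ≤ 12)).trans hx8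
  set a := Real.log x / 2 with ha_def
  have hxa : Real.exp (2 * a) = x := by rw [ha_def, show 2 * (Real.log x / 2) = Real.log x by ring, Real.exp_log hx0]
  have ha6 : 6 ≤ a := by
    have : Real.log (Real.exp 12) ≤ Real.log x := Real.log_le_log (Real.exp_pos 12) hx8
    rw [Real.log_exp] at this; rw [ha_def]; linarith
  have ha4 : 4 ≤ a := by linarith
  have ha0 : a₀ ≤ a := by
    have h1 : Real.exp (2 * a₀) ≤ x := (le_max_left _ _).trans hx
    have : Real.log (Real.exp (2 * a₀)) ≤ Real.log x := Real.log_le_log (Real.exp_pos _) h1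
    rw [Real.log_exp] at this; rw [ha_def]; linarith
  have hapos : 0 < a := by linarith
  set E := Real.exp a with hE
  have hEx : E = Real.sqrt x := by
    rw [hE, ← hxa, show Real.exp (2 * a) = Real.exp a * Real.exp a by rw [← Real.exp_add]; ring_nf,
      Real.sqrt_mul_self (Real.exp_pos a).le]
  have hEpos : 0 < E := Real.exp_pos a
  have hE2 : Real.exp (2 * a) = E ^ 2 := by rw [hE, ← Real.exp_nat_mul]; norm_num
  obtain ⟨hE20, -⟩ := exp_ge_of_three_le (by linarith : (3 : ℝ) ≤ a)
  have hEinv : Real.exp (-a) * E = 1 := by rw [hE, ← Real.exp_add]; simp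
  have hEinv0 : 0 < Real.exp (-a) := Real.exp_pos _
  have hEinv_le : Real.exp (-a) ≤ 1 / 20 := by
    rw [le_div_iff₀ (by norm_num : (0:ℝ) < 20)]; nlinarith
  -- the floor bound at this `a`
  have hfl : farCoercivityFloor a ≤ E + 2 * a + C := by
    have h1 := hU a ha0
    have h2 := pntFloor_le_exp_add_two_mul_of_six_le ha6
    linarith
  -- the Rayleigh quotient of `χ_a` lies below the floor
  obtain ⟨hm, hb, hs⟩ := coshTest_admissible a
  have hnorm := integral_coshTest_sq hapos.le
  have hsinh : Real.sinh a ≤ E / 2 := by rw [Real.sinh_eq]; linarith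
  have hpos : 0 < ∫ y, (Icc (-a) a).indicator (fun y ↦ Real.cosh (y / 2)) y ^ 2 := by
    rw [hnorm]; linarith [Real.sinh_pos_iff.2 hapos]
  have hle := le_csSup (primeShiftQuotients_bddAbove a) ⟨_, Real.cosh (a / 2), hm, hb, hs, hpos, rfl⟩
  have hQ : primeShiftForm a ((Icc (-a) a).indicator (fun y ↦ Real.cosh (y / 2))) ≤ (E + 2 * a + C) * (a + Real.sinh a) := by
    have := hle.trans hfl
    rw [div_le_iff₀ hpos, hnorm] at this
    exact this
  rw [primeShiftForm_coshTest a] at hQ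
  set X := ⌊Real.exp (2 * a)⌋₊ with hX
  have hX1 : 1 ≤ Real.exp (2 * a) := Real.one_le_exp (by linarith)
  have hsplit : ∑ n ∈ Finset.Ioc 0 X,
      (Λ n : ℝ) * (Real.exp a / n - Real.exp (-a) + (2 * a - Real.log n) * (1 + 1 / n) / 2)
      = E * (∑ n ∈ Finset.Ioc 0 X, (Λ n : ℝ) / n) - Real.exp (-a) * (∑ n ∈ Finset.Ioc 0 X, (Λ n : ℝ))
        + ∑ n ∈ Finset.Ioc 0 X, (Λ n : ℝ) * ((2 * a - Real.log n) * (1 + 1 / n) / 2) := by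
    rw [Finset.mul_sum, Finset.mul_sum, ← Finset.sum_sub_distrib, ← Finset.sum_add_distrib]
    refine Finset.sum_congr rfl fun n _ ↦ ?_
    ring
  rw [hsplit] at hQ
  -- (i) Mertens from below, (ii) Chebyshev from above
  have hM : 2 * a - 4 ≤ ∑ n ∈ Finset.Ioc 0 X, (Λ n : ℝ) / n := by
    have h := vonMangoldt_div_sum_ge hX1
    rwa [Real.log_exp] at h
  have hψ : ∑ n ∈ Finset.Ioc 0 X, (Λ n : ℝ) ≤ 1106 / 1000 * E ^ 2 + 12 * a ^ 2 + 80 := by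
    have h := vonMangoldt_sum_floor_exp_le hapos
    rwa [← hX, ← hE] at h
  -- (iii) the weighted sum dominates `W(x)/2`
  have hW : (∫ t in (1:ℝ)..x, t⁻¹ * ψ t) / 2
      ≤ ∑ n ∈ Finset.Ioc 0 X, (Λ n : ℝ) * ((2 * a - Real.log n) * (1 + 1 / n) / 2) := by
    have h := logRiesz_half_le_weightedSum hapos
    rwa [← hX, hxa] at h
  -- assemble: `W/2 ≤ (E + 2a + C)(a + E/2) − E(2a − 4) + 1.106E + (12a² + 80)/20`
  have hMl : E * (2 * a - 4) ≤ E * ∑ n ∈ Finset.Ioc 0 X, (Λ n : ℝ) / n := mul_le_mul_of_nonneg_left hM hEpos.le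
  have hC : C ≤ |C| := le_abs_self C
  have hCa : C * a ≤ |C| * a := mul_le_mul_of_nonneg_right hC hapos.le
  have hCE : C * (E / 2) ≤ |C| * (E / 2) := mul_le_mul_of_nonneg_right hC (by linarith)
  have hT : (E + 2 * a + C) * (a + Real.sinh a) ≤ (E + 2 * a + |C|) * (a + E / 2) := by
    have h1 : (E + 2 * a + C) * (a + Real.sinh a) ≤ (E + 2 * a + |C|) * (a + Real.sinh a) :=
      mul_le_mul_of_nonneg_right (by linarith) (by linarith [Real.sinh_pos_iff.2 hapos])
    have h2 : (E + 2 * a + |C|) * (a + Real.sinh a) ≤ (E + 2 * a + |C|) * (a + E / 2) :=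
      mul_le_mul_of_nonneg_left (by linarith) (by positivity)
    linarith
  have haE : a ≤ E := by linarith [Real.add_one_le_exp a]
  have hWle := law_arith1 hEpos.le hQ hT hMl hEinv0.le hEinv hEinv_le hψ hW
  have hK := law_arith2 (C := C) ha4 (exp_ge_quadratic_of_four_le ha4) haE
  have hx' : x = E ^ 2 := by rw [← hxa, hE2]
  rw [← hEx]
  linarith [hWle, hK, hx']

/-- **THE UPPER CLAUSE OF THE FLOOR LAW FORCES RH.**  If `λ_max(a) ≤ pntFloor a − 2γ_E + C` for all `a ≥ a₀` (in particular under
STRUCTURE.md's C-XIII, `FarFloorDiscrepancyLe C a₀`), then `riemannZeta` has no zero with real part `> ½`: such a zero `ρ₀` and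
`b ∈ (½, Re ρ₀)` would give `W(x) − x ≥ x^b` frequently (`LogRiesz.frequently_rpow_le_logRiesz_sub`, Landau) against
`W(x) − x ≤ K√x` (`logRiesz_sub_le_of_farFloor_le`). -/
theorem riemannHypothesis_of_farFloor_le {C a₀ : ℝ}
    (hU : ∀ a : ℝ, a₀ ≤ a → farCoercivityFloor a ≤ pntFloor a - 2 * Real.eulerMascheroniConstant + C) :
    RiemannHypothesis := by
  obtain ⟨K, X₁, hK⟩ := logRiesz_sub_le_of_farFloor_le hU
  refine Literature.NumberTheory.LFunctions.quasiRiemannHypothesis_one_half_iff_holds.1 fun ρ₀ hζ hρ _ ↦ ?_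
  set b : ℝ := (1 / 2 + ρ₀.re) / 2 with hb
  have hb0 : 0 < b := by rw [hb]; linarith
  have hbρ : b < ρ₀.re := by rw [hb]; linarith
  have hbh : 1 / 2 < b := by rw [hb]; linarith
  have hfreq := LogRiesz.frequently_rpow_le_logRiesz_sub hζ hb0 hbρ
  -- eventually `K√x < x^b`
  have hev : ∀ᶠ x : ℝ in atTop, K * Real.sqrt x < x ^ b ∧ X₁ ≤ x := by
    have ht := (tendsto_rpow_atTop (by linarith : 0 < b - 1 / 2)).eventually_gt_atTop K
    filter_upwards [ht, eventually_ge_atTop X₁, eventually_gt_atTop (0 : ℝ)] with x hx hX hx0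
    refine ⟨?_, hX⟩
    have hsq : Real.sqrt x = x ^ (1 / 2 : ℝ) := Real.sqrt_eq_rpow x
    have hxb : x ^ b = x ^ (1 / 2 : ℝ) * x ^ (b - 1 / 2) := by
      rw [← Real.rpow_add hx0]; ring_nf
    rw [hsq, hxb]
    have hpos : 0 < x ^ (1 / 2 : ℝ) := Real.rpow_pos_of_pos hx0 _
    nlinarith
  obtain ⟨x, hxb, hlt, hX⟩ := (hfreq.and_eventually hev).exists
  have := hK x hX
  linarith

/-- **C-XIII ⟹ RH**: `FarFloorDiscrepancyLe C a₀ → RiemannHypothesis` (only the upper half of the `|·| ≤ C` clause is used). -/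
theorem riemannHypothesis_of_farFloorDiscrepancyLe {C a₀ : ℝ} (h : FarFloorDiscrepancyLe C a₀) :
    RiemannHypothesis :=
  riemannHypothesis_of_farFloor_le (C := C) (a₀ := a₀) fun a ha ↦ by
    have := (abs_le.1 (h a ha)).2; linarith

end FloorCosh

end Summit.RiemannHypothesis.RiemannHypothesis.Theorems.WeilFormatC
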